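import Summits.RiemannHypothesis.RiemannHypothesis.Theses.LeeYang
import Literature.NumberTheory.LFunctions.PolyaKernelRHProofs
import HarnessLib

/-!
# RiemannHypothesis / LeeYang — assembly item `Assembly` (Lee–Yang property of `Φ du` ⇒ RH)

Route `RiemannHypothesis/LeeYang`, item `stmt-RiemannHypothesis-0452`:
`Assembly := (∀ z : ℂ, ∫ u, e^{zu} Φ(u) du = 0 → z.re = 0) → Summit.RiemannHypothesis`, with
`Φ = Literature.NumberTheory.LFunctions.deBruijnPhi` the Pólya–de Bruijn kernel.

If every zero of the two-sided Laplace transform `z ↦ ∫_ℝ e^{zu} Φ(u) du` is purely imaginary then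
the Riemann hypothesis holds: by Pólya's representation `∫_ℝ e^{zu} Φ(u) du = 2·H₀(iz)`
(`Literature.NumberTheory.LFunctions.integral_exp_mul_deBruijnPhi`; `Φ` even, `cosh(zu) = cos(izu)`)
the zeros of `H₀ = ξ(½ + i·/2)/8` are then all real, which is RH
(`Literature.NumberTheory.LFunctions.riemannHypothesis_iff_hasOnlyRealZeros_deBruijnH_zero_holds`).
This composite is exactly the Literature fact
`Literature.NumberTheory.LFunctions.riemannHypothesis_of_deBruijnPhi_laplace_zeros`, discharged in the
tree (`riemannHypothesis_of_deBruijnPhi_laplace_zeros_holds`, `PolyaKernelRHProofs.lean`), and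
`Summit.RiemannHypothesis` is by definition Mathlib's `RiemannHypothesis` (`Summit.RiemannHypothesis_iff`);
so the item is closed by citing that theorem. (The same implication is the last step of the route's
deciding theorem `Summit.RiemannHypothesis.RiemannHypothesis.Theses.LeeYang.closes`.)
-/

namespace Summit.RiemannHypothesis.RiemannHypothesis.Theorems

/-- **Item `stmt-RiemannHypothesis-0452` (`LeeYang.Assembly`).** If every zero of the two-sided
Laplace transform `z ↦ ∫_ℝ e^{zu} Φ(u) du` of the Pólya–de Bruijn kernel `Φ = deBruijnPhi` is purely
imaginary, then the Riemann hypothesis holds (Pólya 1926: `∫ e^{zu} Φ = 2·H₀(iz)`,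
`H₀(w) = ξ(½ + iw/2)/8`; this is the discharged Literature fact
`Literature.NumberTheory.LFunctions.riemannHypothesis_of_deBruijnPhi_laplace_zeros_holds`). [folklore] -/
theorem leeYangAssembly_proof :
    Summit.RiemannHypothesis.RiemannHypothesis.Theses.LeeYang.Assembly := by
  unfold Summit.RiemannHypothesis.RiemannHypothesis.Theses.LeeYang.Assembly
  exact Literature.NumberTheory.LFunctions.riemannHypothesis_of_deBruijnPhi_laplace_zeros_holds

end Summit.RiemannHypothesis.RiemannHypothesis.Theorems
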